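import Summits.CriticalPhenomena.PercolationContinuityZ3.Theorems.PercNearOneGluingNoHeavyLowerTailAntipodalR1PocketInvolution
import HarnessLib

/-!
# The pocket flip, IV: the flip is a bijection between the singly attached parts — ANTI₁-GRADED is equivalent to its multiply attached residue

Support file for `stmt-CriticalPhenomena-4575` (memo `prim-gen-kcluster/KCLUSTER-gen79.md` §1; conjecture
ANTI₁-GRADED of `KCLUSTER-gen52.md` §3 / hypothesis `Hirr` of `AntipodalR1.card_lSet_grade_le_of_irreducible`).
No definitions, no named facts, no sorries.  Continuation of parts I–III (`…PocketFlip`, `…PocketGrade`,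
`…PocketInvolution`); terminology (singly attached on the `L` side / on the `R` side) as in part III.

* `AntipodalR1.pocketUnflip_spec`: for a singly attached `y ∈ R(b,c)` the colouring `x = Ψ_c(y)` obtained by
  reversing every edge touching `S = region ends ȳ a c` (the component of `c` in the support graph minus `O_a(y)`)
  lies in `L`, is singly attached, has pocket `S`, the same grade, and its pocket flip is `y`.  (Proof: apply parts
  I–III to the complementary colouring `ȳ`, whose pocket of `c` w.r.t. `K_a(ȳ) = O_a(y)` is `S`; the separation
  `K_a(x)` separates `b` from `c` holds because every support path leaving `S` passes through a boundary vertex,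
  and boundary vertices lie in `O_a` of the flip.)
* `AntipodalR1.card_rSet_attached_grade_le`: `#{y ∈ R(b,c) : singly attached, g = t} ≤ #{x ∈ L : singly attached, g = t}`,
  hence with part III **equality** `AntipodalR1.card_lSet_attached_grade_eq`.
* `AntipodalR1.card_lSet_grade_le_iff_residual`: **ANTI₁-GRADED ⟺ RESIDUE** — for every finite edge system and
  all `a, b, c`: `(∀ t, #{x ∈ L : g = t} ≤ #{y ∈ R(b,c) : g = t}) ↔
  (∀ t, #{x ∈ L : not singly attached, g = t} ≤ #{y ∈ R(b,c) : not singly attached, g = t})`.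
So the open hypothesis `Hirr` is EXACTLY the level inequality between the multiply attached elements of `L`
(the pocket of `c` hangs from at least two open clusters of the rest) and the multiply attached elements of
`R(b,c)` (the pocket of `c` avoiding `O_a` hangs from at least two closed clusters of the rest).  [this work]
-/

namespace Summit.CriticalPhenomena.PercolationContinuityZ3.Theorems

namespace AntipodalR1

open Finset Relation SimpleGraph

variable {V ι : Type*}

section Unflip

variable {ends : ι → Sym2 V} {x y : ι → Bool} {a b c : V}

/-- Double complement of a colouring. [this work] -/
theorem flip_flip (x : ι → Bool) : (fun i => !(fun j => !x j) i) = x :=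
  funext fun i => Bool.not_not (x i)

/-- The coloured edge set of the complementary colouring. [this work] -/
theorem colEdgeSet_flip (ends : ι → Sym2 V) (y : ι → Bool) (col : Bool) :
    {s : Sym2 V | ∃ e, (fun i => !y i) e = col ∧ ends e = s} = {s | ∃ e, y e = !col ∧ ends e = s} := by
  ext s
  simp only [Set.mem_setOf_eq]
  constructor
  · rintro ⟨e, he, hs⟩
    refine ⟨e, ?_, hs⟩
    cases h : y e <;> cases col <;> simp_all
  · rintro ⟨e, he, hs⟩
    refine ⟨e, ?_, hs⟩
    cases h : y e <;> cases col <;> simp_all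

/-- The grade is invariant under the global colour swap. [this work] -/
theorem grade_flip [Finite V] (ends : ι → Sym2 V) (y : ι → Bool) :
    Nat.card (fromEdgeSet {s : Sym2 V | ∃ e, (fun i => !y i) e = true ∧ ends e = s}).ConnectedComponent +
        Nat.card (fromEdgeSet {s : Sym2 V | ∃ e, (fun i => !y i) e = false ∧ ends e = s}).ConnectedComponent =
      Nat.card (fromEdgeSet {s : Sym2 V | ∃ e, y e = true ∧ ends e = s}).ConnectedComponent +
        Nat.card (fromEdgeSet {s : Sym2 V | ∃ e, y e = false ∧ ends e = s}).ConnectedComponent := by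
  rw [colEdgeSet_flip, colEdgeSet_flip, Bool.not_true, Bool.not_false, Nat.add_comm]

open Classical in
/-- **The unflip of a singly attached element of `R(b,c)`.**  Let `y ∈ R(b,c)` be singly attached,
`S = region ends ȳ a c`, and `x = Ψ_c(y)` the colouring reversing every edge touching `S`.  Then `x ∈ L`, the
pocket of `x` is `S`, `x` is singly attached, `g(x) = g(y)`, and the pocket flip of `x` is `y`. [this work] -/
theorem pocketUnflip_spec [Finite V] [Fintype ι] [DecidableEq ι] (hyR : y ∈ rSet ends a b c)
    (hattR : ∀ w, w ∉ region ends (fun i => !y i) a c →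
      (∃ e u, ends e = s(w, u) ∧ u ∈ region ends (fun i => !y i) a c) →
      ReflTransGen (fun u w => w ∈ nbr ends y false u ∧
        u ∉ region ends (fun i => !y i) a c ∧ w ∉ region ends (fun i => !y i) a c) a w)
    (hx : ∀ e, x e = if (∃ v, v ∈ ends e ∧ v ∈ region ends (fun i => !y i) a c) then !y e else y e) :
    x ∈ lSet ends a b c ∧ region ends x a c = region ends (fun i => !y i) a c ∧
      (∀ w, w ∉ region ends x a c → (∃ e u, ends e = s(w, u) ∧ u ∈ region ends x a c) →
        ReflTransGen (fun u w => w ∈ nbr ends x true u ∧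
          u ∉ region ends x a c ∧ w ∉ region ends x a c) a w) ∧
      Nat.card (fromEdgeSet {s : Sym2 V | ∃ e, x e = true ∧ ends e = s}).ConnectedComponent +
          Nat.card (fromEdgeSet {s : Sym2 V | ∃ e, x e = false ∧ ends e = s}).ConnectedComponent =
        Nat.card (fromEdgeSet {s : Sym2 V | ∃ e, y e = true ∧ ends e = s}).ConnectedComponent +
          Nat.card (fromEdgeSet {s : Sym2 V | ∃ e, y e = false ∧ ends e = s}).ConnectedComponent ∧
      (∀ e, y e = if (∃ v, v ∈ ends e ∧ v ∈ region ends x a c) then !x e else x e) := by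
  obtain ⟨hbO, hbK, hcK, hcO⟩ := mem_rSet.1 hyR
  -- the complementary colouring `z = ȳ` and its pocket flip `y' = x̄`
  have hcz : c ∉ clus ends (fun i => !y i) false a := by rw [mem_clus_flip]; exact hcO
  have hczO : c ∈ clus ends (fun i => !y i) true a := by rw [mem_clus_flip]; exact hcK
  have hbz : b ∈ clus ends (fun i => !y i) false a := by rw [mem_clus_flip]; exact hbO
  have hbzO : b ∉ clus ends (fun i => !y i) true a := by rw [mem_clus_flip]; exact hbK
  have hy' : ∀ e, (fun i => !x i) e =
      if (∃ v, v ∈ ends e ∧ v ∈ region ends (fun i => !y i) a c) then !(fun i => !y i) e else (fun i => !y i) e := by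
    intro e
    dsimp only
    rw [hx e]
    by_cases h : ∃ v, v ∈ ends e ∧ v ∈ region ends (fun i => !y i) a c
    · rw [if_pos h, if_pos h, Bool.not_not]
    · rw [if_neg h, if_neg h]
  have hattz : ∀ w, w ∉ region ends (fun i => !y i) a c →
      (∃ e u, ends e = s(w, u) ∧ u ∈ region ends (fun i => !y i) a c) →
      ReflTransGen (fun u w => w ∈ nbr ends (fun i => !y i) true u ∧
        u ∉ region ends (fun i => !y i) a c ∧ w ∉ region ends (fun i => !y i) a c) a w := by
    intro w hw hadj
    refine path_mono (fun p q h => ?_) (hattR w hw hadj)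
    rw [nbr_flip, Bool.not_true]
    exact h
  -- the pocket of `x` is `S`
  have hQ : region ends x a c = region ends (fun i => !y i) a c := by
    rw [pocket_eq_region_flip hcz hy' hattz, flip_flip]
  -- `x` is singly attached
  have hattx : ∀ w, w ∉ region ends x a c → (∃ e u, ends e = s(w, u) ∧ u ∈ region ends x a c) →
      ReflTransGen (fun u w => w ∈ nbr ends x true u ∧
        u ∉ region ends x a c ∧ w ∉ region ends x a c) a w := by
    have h := pocketFlip_attached hcz hy' hattz
    rw [flip_flip] at h
    intro w hw hadj
    refine path_mono (fun p q hpq => ?_) (h w hw hadj)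
    rw [nbr_flip, Bool.not_false] at hpq
    exact hpq
  -- membership in `L`
  have hxL : x ∈ lSet ends a b c := by
    have e1 : clus ends x true a = clus ends (fun i => !x i) false a := by
      ext v; rw [mem_clus_flip, Bool.not_false]
    have e2 : clus ends x false a = clus ends (fun i => !x i) true a := by
      ext v; rw [mem_clus_flip, Bool.not_true]
    refine mem_lSet.2 ⟨?_, ?_, ?_, ?_, ?_⟩
    · rw [e1]; exact clus_false_subset_pocketFlip hcz hy' hbz
    · rw [e2]; exact fun h => hbzO (pocketFlip_clus_true_subset_clus hcz hy' h)
    · rw [e1]; exact apex_mem_pocketFlip_clus_false hcz hczO hy'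
    · rw [e2]; exact fun h => (pocketFlip_clus_true_subset hcz hy' h).1 ReflTransGen.refl
    · -- separation: a support path from `b` avoiding `K_a(x)` never enters `S`
      intro hreg
      rw [mem_region] at hreg
      have key : ∀ v, ReflTransGen (fun u w => w ∈ freeNbr ends x a u) b v →
          v ∉ region ends (fun i => !y i) a c := by
        intro v hv
        induction hv with
        | refl => exact fun h => not_mem_clus_of_region hcz h hbz
        | @tail u w _ huw ih =>
          intro hwS
          obtain ⟨⟨e, he⟩, huK, _⟩ := huw
          rw [e2] at huK
          exact huK (mem_pocketFlip_clus_true_of_path hy' (hattz u ih ⟨e, w, he, hwS⟩))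
      exact key c hreg ReflTransGen.refl
  refine ⟨hxL, hQ, hattx, ?_, ?_⟩
  · -- grade
    have hg := grade_pocketFlip hcz hy' hattz
    rw [grade_flip, grade_flip] at hg
    exact hg
  · -- the pocket flip of `x` is `y`
    intro e
    rw [hQ, hx e]
    by_cases h : ∃ v, v ∈ ends e ∧ v ∈ region ends (fun i => !y i) a c
    · rw [if_pos h, if_pos h, Bool.not_not]
    · rw [if_neg h, if_neg h]

end Unflip

section Counting

variable [Finite V] [Fintype ι] [DecidableEq ι] (ends : ι → Sym2 V) (a b c : V)

open Classical in
/-- **The converse injection.**  For every level `t`: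
`#{y ∈ R(b,c) : singly attached, g(y) = t} ≤ #{x ∈ L : singly attached, g(x) = t}` (by the unflip `Ψ_c`).
[this work] -/
theorem card_rSet_attached_grade_le (t : ℕ) :
    ((rSet ends a b c).filter fun y =>
        (∀ w, w ∉ region ends (fun i => !y i) a c →
          (∃ e u, ends e = s(w, u) ∧ u ∈ region ends (fun i => !y i) a c) →
          ReflTransGen (fun u w => w ∈ nbr ends y false u ∧
            u ∉ region ends (fun i => !y i) a c ∧ w ∉ region ends (fun i => !y i) a c) a w) ∧
        Nat.card (fromEdgeSet {s : Sym2 V | ∃ e, y e = true ∧ ends e = s}).ConnectedComponent +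
          Nat.card (fromEdgeSet {s : Sym2 V | ∃ e, y e = false ∧ ends e = s}).ConnectedComponent = t).card ≤
      ((lSet ends a b c).filter fun x =>
        (∀ w, w ∉ region ends x a c → (∃ e u, ends e = s(w, u) ∧ u ∈ region ends x a c) →
          ReflTransGen (fun u w => w ∈ nbr ends x true u ∧
            u ∉ region ends x a c ∧ w ∉ region ends x a c) a w) ∧
        Nat.card (fromEdgeSet {s : Sym2 V | ∃ e, x e = true ∧ ends e = s}).ConnectedComponent +
          Nat.card (fromEdgeSet {s : Sym2 V | ∃ e, x e = false ∧ ends e = s}).ConnectedComponent = t).card := by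
  refine Finset.card_le_card_of_injOn
    (fun y e => if (∃ v, v ∈ ends e ∧ v ∈ region ends (fun i => !y i) a c) then !y e else y e) ?_ ?_
  · intro y hy
    rw [Finset.mem_coe, Finset.mem_filter] at hy
    obtain ⟨hyR, hattR, hyg⟩ := hy
    obtain ⟨hxL, -, hattx, hg, -⟩ := pocketUnflip_spec hyR hattR
      (x := fun e => if (∃ v, v ∈ ends e ∧ v ∈ region ends (fun i => !y i) a c) then !y e else y e)
      (fun _ => rfl)
    rw [Finset.mem_coe, Finset.mem_filter]
    exact ⟨hxL, hattx, hg.trans hyg⟩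
  · intro y₁ hy₁ y₂ hy₂ h
    rw [Finset.mem_coe, Finset.mem_filter] at hy₁ hy₂
    have h' : (fun e => if (∃ v, v ∈ ends e ∧ v ∈ region ends (fun i => !y₁ i) a c) then !y₁ e else y₁ e) =
        (fun e => if (∃ v, v ∈ ends e ∧ v ∈ region ends (fun i => !y₂ i) a c) then !y₂ e else y₂ e) := by
      have h'' := h; dsimp only at h''; exact h''
    obtain ⟨-, -, -, -, hflip₁⟩ := pocketUnflip_spec hy₁.1 hy₁.2.1
      (x := fun e => if (∃ v, v ∈ ends e ∧ v ∈ region ends (fun i => !y₁ i) a c) then !y₁ e else y₁ e)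
      (fun _ => rfl)
    obtain ⟨-, -, -, -, hflip₂⟩ := pocketUnflip_spec hy₂.1 hy₂.2.1
      (x := fun e => if (∃ v, v ∈ ends e ∧ v ∈ region ends (fun i => !y₂ i) a c) then !y₂ e else y₂ e)
      (fun _ => rfl)
    have key : ∀ (X₁ X₂ : ι → Bool), X₁ = X₂ → ∀ e,
        (if (∃ v, v ∈ ends e ∧ v ∈ region ends X₁ a c) then !X₁ e else X₁ e) =
          (if (∃ v, v ∈ ends e ∧ v ∈ region ends X₂ a c) then !X₂ e else X₂ e) := by
      intro X₁ X₂ hX e; subst hX; rfl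
    funext e
    rw [hflip₁ e, hflip₂ e]
    exact key _ _ h' e

open Classical in
/-- **The pocket flip is a graded bijection between the singly attached parts of `L` and `R(b,c)`.**
[this work] -/
theorem card_lSet_attached_grade_eq (t : ℕ) :
    ((lSet ends a b c).filter fun x =>
        (∀ w, w ∉ region ends x a c → (∃ e u, ends e = s(w, u) ∧ u ∈ region ends x a c) →
          ReflTransGen (fun u w => w ∈ nbr ends x true u ∧
            u ∉ region ends x a c ∧ w ∉ region ends x a c) a w) ∧
        Nat.card (fromEdgeSet {s : Sym2 V | ∃ e, x e = true ∧ ends e = s}).ConnectedComponent +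
          Nat.card (fromEdgeSet {s : Sym2 V | ∃ e, x e = false ∧ ends e = s}).ConnectedComponent = t).card =
      ((rSet ends a b c).filter fun y =>
        (∀ w, w ∉ region ends (fun i => !y i) a c →
          (∃ e u, ends e = s(w, u) ∧ u ∈ region ends (fun i => !y i) a c) →
          ReflTransGen (fun u w => w ∈ nbr ends y false u ∧
            u ∉ region ends (fun i => !y i) a c ∧ w ∉ region ends (fun i => !y i) a c) a w) ∧
        Nat.card (fromEdgeSet {s : Sym2 V | ∃ e, y e = true ∧ ends e = s}).ConnectedComponent +
          Nat.card (fromEdgeSet {s : Sym2 V | ∃ e, y e = false ∧ ends e = s}).ConnectedComponent = t).card :=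
  le_antisymm (card_lSet_attached_grade_le ends a b c t) (card_rSet_attached_grade_le ends a b c t)

open Classical in
/-- **ANTI₁-GRADED IS EQUIVALENT TO ITS MULTIPLY ATTACHED RESIDUE.**  For every finite edge system and all
`a, b, c`: the level inequalities `#{x ∈ L : g = t} ≤ #{y ∈ R(b,c) : g = t}` hold for all `t` iff they hold
between the elements of `L` and of `R(b,c)` that are NOT singly attached at `c`. [this work] -/
theorem card_lSet_grade_le_iff_residual :
    (∀ t : ℕ,
      ((lSet ends a b c).filter fun x =>
        Nat.card (fromEdgeSet {s : Sym2 V | ∃ e, x e = true ∧ ends e = s}).ConnectedComponent +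
          Nat.card (fromEdgeSet {s : Sym2 V | ∃ e, x e = false ∧ ends e = s}).ConnectedComponent = t).card ≤
      ((rSet ends a b c).filter fun y =>
        Nat.card (fromEdgeSet {s : Sym2 V | ∃ e, y e = true ∧ ends e = s}).ConnectedComponent +
          Nat.card (fromEdgeSet {s : Sym2 V | ∃ e, y e = false ∧ ends e = s}).ConnectedComponent = t).card) ↔
    (∀ t : ℕ,
      ((lSet ends a b c).filter fun x =>
        (¬ ∀ w, w ∉ region ends x a c → (∃ e u, ends e = s(w, u) ∧ u ∈ region ends x a c) →
          ReflTransGen (fun u w => w ∈ nbr ends x true u ∧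
            u ∉ region ends x a c ∧ w ∉ region ends x a c) a w) ∧
        Nat.card (fromEdgeSet {s : Sym2 V | ∃ e, x e = true ∧ ends e = s}).ConnectedComponent +
          Nat.card (fromEdgeSet {s : Sym2 V | ∃ e, x e = false ∧ ends e = s}).ConnectedComponent = t).card ≤
      ((rSet ends a b c).filter fun y =>
        (¬ ∀ w, w ∉ region ends (fun i => !y i) a c →
          (∃ e u, ends e = s(w, u) ∧ u ∈ region ends (fun i => !y i) a c) →
          ReflTransGen (fun u w => w ∈ nbr ends y false u ∧
            u ∉ region ends (fun i => !y i) a c ∧ w ∉ region ends (fun i => !y i) a c) a w) ∧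
        Nat.card (fromEdgeSet {s : Sym2 V | ∃ e, y e = true ∧ ends e = s}).ConnectedComponent +
          Nat.card (fromEdgeSet {s : Sym2 V | ∃ e, y e = false ∧ ends e = s}).ConnectedComponent = t).card) := by
  refine ⟨fun h t => ?_, card_lSet_grade_le_of_residual ends a b c⟩
  have h0 := h t
  have h1 := card_lSet_attached_grade_eq ends a b c t
  have splitL := Finset.card_filter_add_card_filter_not
    (s := (lSet ends a b c).filter fun x =>
      Nat.card (fromEdgeSet {s : Sym2 V | ∃ e, x e = true ∧ ends e = s}).ConnectedComponent +
        Nat.card (fromEdgeSet {s : Sym2 V | ∃ e, x e = false ∧ ends e = s}).ConnectedComponent = t)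
    (fun x : ι → Bool => ∀ w, w ∉ region ends x a c → (∃ e u, ends e = s(w, u) ∧ u ∈ region ends x a c) →
      ReflTransGen (fun u w => w ∈ nbr ends x true u ∧
        u ∉ region ends x a c ∧ w ∉ region ends x a c) a w)
  have splitR := Finset.card_filter_add_card_filter_not
    (s := (rSet ends a b c).filter fun y =>
      Nat.card (fromEdgeSet {s : Sym2 V | ∃ e, y e = true ∧ ends e = s}).ConnectedComponent +
        Nat.card (fromEdgeSet {s : Sym2 V | ∃ e, y e = false ∧ ends e = s}).ConnectedComponent = t)
    (fun y : ι → Bool => ∀ w, w ∉ region ends (fun i => !y i) a c →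
      (∃ e u, ends e = s(w, u) ∧ u ∈ region ends (fun i => !y i) a c) →
      ReflTransGen (fun u w => w ∈ nbr ends y false u ∧
        u ∉ region ends (fun i => !y i) a c ∧ w ∉ region ends (fun i => !y i) a c) a w)
  rw [Finset.filter_filter, Finset.filter_filter] at splitL splitR
  have eL1 : ((lSet ends a b c).filter fun x =>
      (Nat.card (fromEdgeSet {s : Sym2 V | ∃ e, x e = true ∧ ends e = s}).ConnectedComponent +
        Nat.card (fromEdgeSet {s : Sym2 V | ∃ e, x e = false ∧ ends e = s}).ConnectedComponent = t) ∧
      (∀ w, w ∉ region ends x a c → (∃ e u, ends e = s(w, u) ∧ u ∈ region ends x a c) →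
        ReflTransGen (fun u w => w ∈ nbr ends x true u ∧
          u ∉ region ends x a c ∧ w ∉ region ends x a c) a w)).card =
      ((lSet ends a b c).filter fun x =>
        (∀ w, w ∉ region ends x a c → (∃ e u, ends e = s(w, u) ∧ u ∈ region ends x a c) →
          ReflTransGen (fun u w => w ∈ nbr ends x true u ∧
            u ∉ region ends x a c ∧ w ∉ region ends x a c) a w) ∧
        Nat.card (fromEdgeSet {s : Sym2 V | ∃ e, x e = true ∧ ends e = s}).ConnectedComponent +
          Nat.card (fromEdgeSet {s : Sym2 V | ∃ e, x e = false ∧ ends e = s}).ConnectedComponent = t).card := by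
    congr 1; exact Finset.filter_congr fun x _ => and_comm
  have eL2 : ((lSet ends a b c).filter fun x =>
      (Nat.card (fromEdgeSet {s : Sym2 V | ∃ e, x e = true ∧ ends e = s}).ConnectedComponent +
        Nat.card (fromEdgeSet {s : Sym2 V | ∃ e, x e = false ∧ ends e = s}).ConnectedComponent = t) ∧
      ¬ (∀ w, w ∉ region ends x a c → (∃ e u, ends e = s(w, u) ∧ u ∈ region ends x a c) →
        ReflTransGen (fun u w => w ∈ nbr ends x true u ∧
          u ∉ region ends x a c ∧ w ∉ region ends x a c) a w)).card =
      ((lSet ends a b c).filter fun x =>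
        (¬ ∀ w, w ∉ region ends x a c → (∃ e u, ends e = s(w, u) ∧ u ∈ region ends x a c) →
          ReflTransGen (fun u w => w ∈ nbr ends x true u ∧
            u ∉ region ends x a c ∧ w ∉ region ends x a c) a w) ∧
        Nat.card (fromEdgeSet {s : Sym2 V | ∃ e, x e = true ∧ ends e = s}).ConnectedComponent +
          Nat.card (fromEdgeSet {s : Sym2 V | ∃ e, x e = false ∧ ends e = s}).ConnectedComponent = t).card := by
    congr 1; exact Finset.filter_congr fun x _ => and_comm
  have eR1 : ((rSet ends a b c).filter fun y =>
      (Nat.card (fromEdgeSet {s : Sym2 V | ∃ e, y e = true ∧ ends e = s}).ConnectedComponent +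
        Nat.card (fromEdgeSet {s : Sym2 V | ∃ e, y e = false ∧ ends e = s}).ConnectedComponent = t) ∧
      (∀ w, w ∉ region ends (fun i => !y i) a c →
        (∃ e u, ends e = s(w, u) ∧ u ∈ region ends (fun i => !y i) a c) →
        ReflTransGen (fun u w => w ∈ nbr ends y false u ∧
          u ∉ region ends (fun i => !y i) a c ∧ w ∉ region ends (fun i => !y i) a c) a w)).card =
      ((rSet ends a b c).filter fun y =>
        (∀ w, w ∉ region ends (fun i => !y i) a c →
          (∃ e u, ends e = s(w, u) ∧ u ∈ region ends (fun i => !y i) a c) →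
          ReflTransGen (fun u w => w ∈ nbr ends y false u ∧
            u ∉ region ends (fun i => !y i) a c ∧ w ∉ region ends (fun i => !y i) a c) a w) ∧
        Nat.card (fromEdgeSet {s : Sym2 V | ∃ e, y e = true ∧ ends e = s}).ConnectedComponent +
          Nat.card (fromEdgeSet {s : Sym2 V | ∃ e, y e = false ∧ ends e = s}).ConnectedComponent = t).card := by
    congr 1; exact Finset.filter_congr fun x _ => and_comm
  have eR2 : ((rSet ends a b c).filter fun y =>
      (Nat.card (fromEdgeSet {s : Sym2 V | ∃ e, y e = true ∧ ends e = s}).ConnectedComponent +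
        Nat.card (fromEdgeSet {s : Sym2 V | ∃ e, y e = false ∧ ends e = s}).ConnectedComponent = t) ∧
      ¬ (∀ w, w ∉ region ends (fun i => !y i) a c →
        (∃ e u, ends e = s(w, u) ∧ u ∈ region ends (fun i => !y i) a c) →
        ReflTransGen (fun u w => w ∈ nbr ends y false u ∧
          u ∉ region ends (fun i => !y i) a c ∧ w ∉ region ends (fun i => !y i) a c) a w)).card =
      ((rSet ends a b c).filter fun y =>
        (¬ ∀ w, w ∉ region ends (fun i => !y i) a c →
          (∃ e u, ends e = s(w, u) ∧ u ∈ region ends (fun i => !y i) a c) →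
          ReflTransGen (fun u w => w ∈ nbr ends y false u ∧
            u ∉ region ends (fun i => !y i) a c ∧ w ∉ region ends (fun i => !y i) a c) a w) ∧
        Nat.card (fromEdgeSet {s : Sym2 V | ∃ e, y e = true ∧ ends e = s}).ConnectedComponent +
          Nat.card (fromEdgeSet {s : Sym2 V | ∃ e, y e = false ∧ ends e = s}).ConnectedComponent = t).card := by
    congr 1; exact Finset.filter_congr fun x _ => and_comm
  rw [eL1, eL2] at splitL
  rw [eR1, eR2] at splitR
  omega

end Counting

end AntipodalR1

end Summit.CriticalPhenomena.PercolationContinuityZ3.Theorems
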